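/-
Copyright (c) 2025 Kevin Buzzard. All rights reserved.
Released under Apache 2.0 license as described in the file LICENSE.
Authors: Kevin Buzzard, Andrew Yang, Matthew Jasper
-- (for the material from `FLT/DedekindDomain/IntegralClosure.lean`)
Copyright (c) 2025 Matthew Jasper. All rights reserved.
Released under Apache 2.0 license as described in the file LICENSE.
Authors: Matthew Jasper
-- (for the material from `FLT/Mathlib/RingTheory/Localization/BaseChange.lean`)

Vendored into this tree (Lean v4.32.0 / Mathlib v4.32.0) from the FLT project,
ImperialCollegeLondon/FLT @ 071d16bb51e87165b4f4b5466f14051344bf426b (2026-08-18), Apache-2.0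
[FLTProject2025]. Modifications: see the module docstring ("Provenance and modifications").
-/
import Mathlib.Algebra.Group.Int.TypeTags
import Mathlib.RingTheory.DedekindDomain.AdicValuation
import Mathlib.RingTheory.Localization.BaseChange
import Mathlib.RingTheory.RamificationInertia.Basic
import Mathlib.RingTheory.RamificationInertia.Inertia
import Mathlib.RingTheory.RamificationInertia.Ramification
import Literature.NumberTheory.AdelicBaseChange.AdicCompletionDensity
import HarnessLib

/-!
# The AKLB set-up: primes of `B` above a prime of `A`, `w(x) = v(x)^e`, `Σ e f = [L : K]`, `L ⊗[K] M ≅ B ⊗[A] M`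

Topic `NumberTheory/AdelicBaseChange` — file 5 of the ADELIC BASE-CHANGE PACKET (the FLT project's
proof of `L ⊗[K] K_v ≃ₐ[L] ∏_{w ∣ v} L_w`, `L ⊗[K] 𝔸_K^∞ ≃ₐ[L] 𝔸_L^∞`, `L ⊗[K] 𝔸_K ≃ₐ[L] 𝔸_L`,
vendored module by module; Cassels–Fröhlich, *Algebraic Number Theory*, Ch. II §10, §14). Needs file 1
(`AdicCompletionDensity`, for `HeightOneSpectrum.liesOver_under`). Set-up: `A` a Dedekind domain with
fraction field `K`, `L/K` a finite extension, `B` the integral closure of `A` in `L` (Dedekind, with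
`Frac B = L`).

* `IsLocalization` lemmas: `moduleLid`/`moduleTensorEquiv` on pure tensors, `tensorProduct_ext`
  (ext for maps out of `L ⊗[K] M` checked on `B ⊗ M`), `leftModuleTensorEquiv`;
* `IsDedekindDomain.HeightOneSpectrum.Extension B v = {w // w.under A = v}` — the primes of `B` above
  `v` — is finite (`Extension.finite`, `Extension.fintype`), in bijection with `v.asIdeal.primesOver B`
  (`Extension.equivPrimesOver`); `preimageComapFinset`; multiplicities under `I ↦ I·B`
  (`mk_count_factors_map`), `w(a) = v(a)^{e(w|v)}` on `A` and on `K` (`intValuation_comap`,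
  `valuation_comap` — Mathlib has the `LiesOver` form `valuation_liesOver`), and the fundamental
  identity summed over `Extension B v`: `Ideal.sum_ramification_inertia_extensions :
  Σ_w e(w|v) f(w|v) = [L : K]` (from Mathlib's `Ideal.sum_ramification_inertia_eq_finrank` and
  `[L : K] = rank_A B` — FLT's `IsFractionRing.finrank_eq` of its newer Mathlib, which at this pin is
  `Algebra.IsAlgebraic.finrank_of_isFractionRing`);
* `LinearEquivTensorProduct : L ≃ₗ[K] K ⊗[A] B`, `linearEquivTensorProductModule(Left) :
  L ⊗[K] M ≃ₗ[A] (≃ₗ[B]) B ⊗[A] M`, and `IsIntegralClosure.isLocalizedModule` (`L = (A∖0)⁻¹ B` as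
  `A`-modules).

Everything is PROVED; no named facts. The STATEMENTS are, verbatim, those of the published FLT
project, so every declaration carries the provenance tag `[cite: FLTProject2025, <FLT file> · <FLT
name>]` (the gate's cited-only rule for `Literature/`).

## Provenance and modifications (Apache-2.0 §4)

Lean source: `FLT/Mathlib/RingTheory/Localization/BaseChange.lean`, `FLT/DedekindDomain/IntegralClosure.lean`
of ImperialCollegeLondon/FLT at commit `071d16bb51e8` (branch `main`, 2026-08-18; Lean v4.34.0-rc1 /
Mathlib `274ed6d6`), concatenated in import order, each in its own `section`. Modifications made
here: (1) back-port to Mathlib v4.32.0 — `module`/`public import`/`@[expose] public section` removed,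
and the one use of `IsFractionRing.finrank_eq A K B L` (a lemma of FLT's newer Mathlib) replaced by the
pin's identical statement `Algebra.IsAlgebraic.finrank_of_isFractionRing A K B L` (no shim is vendored:
that would duplicate a Mathlib theorem);
(2) docstrings and provenance tags added to every declaration, with pointers to the Mathlib
`LiesOver` forms where they exist; the original copyright headers are kept above.
NAMESPACES (CONVENTIONS §2, reviews p318962/p319167): this file has no FLT root-level declarations (the
packet namespace `Literature.NumberTheory.AdelicBaseChange` is merely opened at the top, as in every
packet file); FLT's deliberate extensions of MATHLIB namespaces — here `IsLocalization`,
`IsDedekindDomain(.HeightOneSpectrum, .HeightOneSpectrum.Extension)`, `Ideal`, `IsIntegralClosure` —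
keep their absolute names for dot notation, and each such docstring says so. Short names are FLT's
throughout, so that the later files of the packet, and an eventual Mathlib bump absorbing FLT's
upstreaming, need no renaming; none of them exists in Mathlib v4.32.0 or in the tree.

## References
* J. W. S. Cassels, A. Fröhlich (eds.), *Algebraic Number Theory* (1967), Ch. II §10 (`Σ [L_w : K_v] = [L : K]`). [CasselsFrohlichANT1967]
* K. Buzzard, R. Taylor et al., *FLT* (Lean 4 project), Imperial College London, 2025–. [FLTProject2025]
-/

namespace Literature.NumberTheory.AdelicBaseChange
-- the packet namespace (CONVENTIONS §2): FLT-root declarations below live in it; it is opened here so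
-- that FLT's cross-references between them and its Mathlib-namespace extensions resolve unchanged.
end Literature.NumberTheory.AdelicBaseChange

open Literature.NumberTheory.AdelicBaseChange

/-! ## From `FLT/Mathlib/RingTheory/Localization/BaseChange.lean` -/

section

-- *TODO* should these simp lemmas be in mathlib?


section

namespace IsLocalization

section

variable {R : Type*} [CommSemiring R] (S : Submonoid R)
  (A : Type*) [CommSemiring A] [Algebra R A] [IsLocalization S A]
  (M₁ : Type*) [AddCommMonoid M₁] [Module R M₁] [Module A M₁] [IsScalarTower R A M₁]

/-- `(IsLocalization.moduleLid S A M₁).symm m = 1 ⊗ₜ m`.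
(In Mathlib's namespace `IsLocalization`: a deliberate extension under FLT's name, for dot notation
and so that the later packet files apply unchanged — CONVENTIONS §2.)
[cite: FLTProject2025, FLT/Mathlib/RingTheory/Localization/BaseChange.lean · IsLocalization.moduleLid_symm_apply] -/
@[simp]
lemma moduleLid_symm_apply (m : M₁) : (moduleLid S A M₁).symm m = 1 ⊗ₜ[R] m := rfl

variable (M₂ : Type*) [AddCommMonoid M₂] [Module R M₂] [Module A M₂] [IsScalarTower R A M₂]

/-- `IsLocalization.moduleTensorEquiv` on pure tensors: `m₁ ⊗ₜ[A] m₂ ↦ m₁ ⊗ₜ[R] m₂`.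
(In Mathlib's namespace `IsLocalization`: a deliberate extension under FLT's name, for dot notation
and so that the later packet files apply unchanged — CONVENTIONS §2.)
[cite: FLTProject2025, FLT/Mathlib/RingTheory/Localization/BaseChange.lean · IsLocalization.map_moduleTensorEquiv_tmul] -/
@[simp]
lemma map_moduleTensorEquiv_tmul (m₁ : M₁) (m₂ : M₂) :
    moduleTensorEquiv S A M₁ M₂ (m₁ ⊗ₜ[A] m₂) = m₁ ⊗ₜ[R] m₂ := rfl

/-- The inverse of `IsLocalization.moduleTensorEquiv` on pure tensors: `m₁ ⊗ₜ[R] m₂ ↦ m₁ ⊗ₜ[A] m₂`.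
(In Mathlib's namespace `IsLocalization`: a deliberate extension under FLT's name, for dot notation
and so that the later packet files apply unchanged — CONVENTIONS §2.)
[cite: FLTProject2025, FLT/Mathlib/RingTheory/Localization/BaseChange.lean · IsLocalization.map_moduleTensorEquiv_symm_tmul] -/
@[simp]
lemma map_moduleTensorEquiv_symm_tmul (m₁ : M₁) (m₂ : M₂) :
    (moduleTensorEquiv S A M₁ M₂).symm (m₁ ⊗ₜ[R] m₂) = m₁ ⊗ₜ[A] m₂ := rfl

end

section

open TensorProduct

variable {A : Type*} [CommSemiring A] (S : Submonoid A)
  (B : Type*) [CommSemiring B] [Algebra A B]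
  (K : Type*) [CommSemiring K] [Algebra A K] [IsLocalization S K]
  (L : Type*) [CommSemiring L] [Algebra B L] [Algebra A L] [Algebra K L] [IsScalarTower A B L]
    [IsScalarTower A K L] [IsLocalizedModule (M := B) (M' := L) S (Algebra.linearMap B L)]
  (M : Type*) [AddCommMonoid M] [Module K M]
  (P : Type*) [AddCommMonoid P] [Module K P]

include S in
/-- Extensionality for `K`-linear maps out of `L ⊗[K] M` when `L` is a localization of a
`B`-algebra at `S ⊆ A` and `K = S⁻¹A`: it suffices to agree on tensors `algebraMap B L x ⊗ₜ y`.
(In Mathlib's namespace `IsLocalization`: a deliberate extension under FLT's name, for dot notation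
and so that the later packet files apply unchanged — CONVENTIONS §2.)
[cite: FLTProject2025, FLT/Mathlib/RingTheory/Localization/BaseChange.lean · IsLocalization.tensorProduct_ext] -/
theorem tensorProduct_ext {g h : L ⊗[K] M →ₗ[K] P}
    (H : ∀ (x : B) (y : M), g ((algebraMap _ L x) ⊗ₜ[K] y) = h ((algebraMap _ L x) ⊗ₜ[K] y))
    : g = h := by
  apply TensorProduct.ext'
  intro l m
  obtain ⟨⟨x, s⟩, hl : (s : A) • l = algebraMap B L x⟩ :=
    IsLocalizedModule.surj (M:=B) (M':=L) S (Algebra.linearMap B L) l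
  rw [← IsUnit.smul_left_cancel <| map_units K s]
  simpa [← map_smul, TensorProduct.smul_tmul', IsScalarTower.algebraMap_smul K, hl] using H x m

/-- If `A` is a localization of R, tensoring two A-modules over A is the same as tensoring
them over R. This is `IsLocalization.moduleTensorEquiv` as an `M₁`-linear equivalence (more
generally an `M'`-linear equivalence where `M₁` is an `M'`-module).
(In Mathlib's namespace `IsLocalization`: a deliberate extension under FLT's name, for dot notation
and so that the later packet files apply unchanged — CONVENTIONS §2.)
[cite: FLTProject2025, FLT/Mathlib/RingTheory/Localization/BaseChange.lean · IsLocalization.leftModuleTensorEquiv] -/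
@[simps!]
noncomputable def leftModuleTensorEquiv {R : Type*} (M' : Type*)
    [Semiring M'] [CommSemiring R] (S : Submonoid R) (A : Type*) [CommSemiring A] [Algebra R A]
    [IsLocalization S A] (M₁ : Type*) (M₂ : Type*) [AddCommMonoid M₁] [AddCommMonoid M₂]
    [Module M' M₁] [Module R M₁] [Module R M₂] [Module A M₁] [Module A M₂]
    [SMulCommClass A M' M₁] [SMulCommClass R M' M₁] [IsScalarTower R A M₁]
    [IsScalarTower R A M₂] :
    M₁ ⊗[A] M₂ ≃ₗ[M'] M₁ ⊗[R] M₂ where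
  __ := IsLocalization.moduleTensorEquiv S A M₁ M₂
  map_smul' r x := by
    induction x with
    | zero => simp
    | tmul m₁ m₂ => simp [TensorProduct.smul_tmul']
    | add => simp_all

/-- `IsLocalization.leftModuleTensorEquiv` restricted to `A`-scalars is
`IsLocalization.moduleTensorEquiv`.
(In Mathlib's namespace `IsLocalization`: a deliberate extension under FLT's name, for dot notation
and so that the later packet files apply unchanged — CONVENTIONS §2.)
[cite: FLTProject2025, FLT/Mathlib/RingTheory/Localization/BaseChange.lean · IsLocalization.leftModuleTensorEquiv_restrictScalars_eq] -/
lemma leftModuleTensorEquiv_restrictScalars_eq {R M' : Type*} [CommSemiring M']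
    [CommSemiring R] (S : Submonoid R) (A : Type*) [CommSemiring A] [Algebra R A] [Algebra A M']
    [Algebra M' R] [IsLocalization S A] (M₁ : Type*) (M₂ : Type*) [AddCommMonoid M₁]
    [AddCommMonoid M₂] [Module M' M₁] [Module R M₁] [Module R M₂] [Module A M₁]
    [Module A M₂] [IsScalarTower A M' M₁] [IsScalarTower M' R M₁] [IsScalarTower R A M₁]
    [IsScalarTower R A M₂] :
    (IsLocalization.leftModuleTensorEquiv M' S A M₁ M₂).restrictScalars A =
      IsLocalization.moduleTensorEquiv S A M₁ M₂ := by
  rfl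

end

end IsLocalization

end

end

/-! ## From `FLT/DedekindDomain/IntegralClosure.lean` -/

section

namespace IsDedekindDomain.HeightOneSpectrum

section BaseChange

variable (A K L B : Type*) [CommRing A] [CommRing B] [Algebra A B] [Field K] [Field L]
    [Algebra A K] [IsFractionRing A K] [Algebra B L] [IsDedekindDomain A]
    [Algebra K L] [Algebra A L] [IsScalarTower A B L] [IsScalarTower A K L]
    [IsIntegralClosure B A L] [Algebra.IsIntegral A B] [IsDedekindDomain B]
    [IsFractionRing B L]

variable (v : HeightOneSpectrum A)

variable {A} in
/-- If `B` is an `A`-algebra and `v : HeightOneSpectrum A` is a nonzero prime,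
then `v.Extension B` is the subtype of `HeightOneSpeectrum B` consisting of valuations of `B`
which restrict to `v`.
(In Mathlib's namespace `IsDedekindDomain.HeightOneSpectrum`: a deliberate extension under FLT's
name, for dot notation and so that the later packet files apply unchanged — CONVENTIONS §2.)
[cite: FLTProject2025, FLT/DedekindDomain/IntegralClosure.lean · IsDedekindDomain.HeightOneSpectrum.Extension] -/
def Extension (v : HeightOneSpectrum A) := {w : HeightOneSpectrum B // w.under A = v}

/-- Multiplicities under extension of ideals: for an injective `A → B` of Dedekind domains and a
prime `w` of `B`, the multiplicity of `w` in `I·B` is `e(w|w ∩ A)` times the multiplicity of `w ∩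
A` in `I`.
(In Mathlib's namespace `IsDedekindDomain.HeightOneSpectrum`: a deliberate extension under FLT's
name, for dot notation and so that the later packet files apply unchanged — CONVENTIONS §2.)
[cite: FLTProject2025, FLT/DedekindDomain/IntegralClosure.lean · IsDedekindDomain.HeightOneSpectrum.mk_count_factors_map] -/
lemma mk_count_factors_map
    (hAB : Function.Injective (algebraMap A B))
    (w : HeightOneSpectrum B) (I : Ideal A) :
    (Associates.mk w.asIdeal).count (Associates.mk (Ideal.map (algebraMap A B) I)).factors =
    w.asIdeal.ramificationIdx A *
      (Associates.mk (under A w).asIdeal).count (Associates.mk I).factors := by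
  classical
  induction I using UniqueFactorizationMonoid.induction_on_prime with
  | h₁ =>
    rw [Associates.mk_zero, Ideal.zero_eq_bot, Ideal.map_bot, ← Ideal.zero_eq_bot,
      Associates.mk_zero]
    simp [-under_asIdeal, Associates.count, Associates.factors_zero, w.associates_irreducible,
      associates_irreducible (under A w), Associates.bcount]
  | h₂ I hI =>
    obtain rfl : I = ⊤ := by simpa using hI
    simp only [Ideal.map_top]
    simp only [← Ideal.one_eq_top, Associates.mk_one, Associates.factors_one]
    rw [Associates.count_zero (associates_irreducible _),
      Associates.count_zero (associates_irreducible _), mul_zero]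
  | h₃ I p hI hp IH =>
    simp only [Ideal.map_mul, ← Associates.mk_mul_mk]
    have hp_bot : p ≠ ⊥ := hp.ne_zero
    have hp_bot' := (Ideal.map_eq_bot_iff_of_injective hAB).not.mpr hp_bot
    have hI_bot := (Ideal.map_eq_bot_iff_of_injective hAB).not.mpr hI
    rw [Associates.count_mul (Associates.mk_ne_zero.mpr hp_bot) (Associates.mk_ne_zero.mpr hI)
      (associates_irreducible _), Associates.count_mul (Associates.mk_ne_zero.mpr hp_bot')
      (Associates.mk_ne_zero.mpr hI_bot) (associates_irreducible _)]
    simp only [IH, mul_add]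
    congr 1
    obtain rfl | hw := eq_or_ne (w.under A).asIdeal p
    · have : Irreducible (Associates.mk (under A w).asIdeal) :=
        Associates.irreducible_mk.mpr hp.irreducible
      rw [Associates.factors_self this, Associates.count_some this]
      simp only [Multiset.nodup_singleton, Multiset.mem_singleton, Multiset.count_eq_one_of_mem,
        mul_one]
      rw [Ideal.count_associates_factors_eq hp_bot' w.2 w.3]
      exact (Ideal.IsDedekindDomain.ramificationIdx_eq_normalizedFactors_count _ _ hp_bot').symm
    · have : (Associates.mk (under A w).asIdeal).count (Associates.mk p).factors = 0 :=
        Associates.count_eq_zero_of_ne (associates_irreducible _)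
          (Associates.irreducible_mk.mpr hp.irreducible)
          (by rwa [ne_eq, Associates.mk_eq_mk_iff_associated, associated_iff_eq])
      rw [this, mul_zero, eq_comm]
      by_contra H
      rw [eq_comm, ← ne_eq, Associates.count_ne_zero_iff_dvd hp_bot' (irreducible w),
        Ideal.dvd_iff_le, Ideal.map_le_iff_le_comap] at H
      apply hw (((Ideal.isPrime_of_prime hp).isMaximal hp_bot).eq_of_le
        (under A w).2.ne_top H).symm

/-- The ramification index `e(w | w ∩ A)` of a nonzero prime of `B` is nonzero (injective `A → B`).
(In Mathlib's namespace `IsDedekindDomain.HeightOneSpectrum`: a deliberate extension under FLT's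
name, for dot notation and so that the later packet files apply unchanged — CONVENTIONS §2.)
[cite: FLTProject2025, FLT/DedekindDomain/IntegralClosure.lean · IsDedekindDomain.HeightOneSpectrum.ramificationIdx_ne_zero] -/
lemma ramificationIdx_ne_zero (hAB : Function.Injective (algebraMap A B))
    (w : HeightOneSpectrum B) :
    w.asIdeal.ramificationIdx A ≠ 0 := by
  have hbot : Ideal.map (algebraMap A B) (under A w).asIdeal ≠ ⊥ :=
    (Ideal.map_eq_bot_iff_of_injective hAB).not.mpr (under A w).3
  rw [← Ideal.ramificationIdx'_eq_ramificationIdx' (under A w).asIdeal w.asIdeal hbot]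
  exact Ideal.IsDedekindDomain.ramificationIdx'_ne_zero hbot w.2 Ideal.map_comap_le

/-- If w | v then for a ∈ A we have w(a)=v(a)^e where e is the ramification index.
(Same content as Mathlib's `IsDedekindDomain.HeightOneSpectrum.intValuation_liesOver`, which is
stated with `LiesOver`/`ramificationIdx'`; this is FLT's `under`/`ramificationIdx` form, the one the
base-change files consume.)
(In Mathlib's namespace `IsDedekindDomain.HeightOneSpectrum`: a deliberate extension under FLT's
name, for dot notation and so that the later packet files apply unchanged — CONVENTIONS §2.)
[cite: FLTProject2025, FLT/DedekindDomain/IntegralClosure.lean · IsDedekindDomain.HeightOneSpectrum.intValuation_comap] -/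
lemma intValuation_comap (hAB : Function.Injective (algebraMap A B))
    (w : HeightOneSpectrum B) (x : A) :
    (under A w).intValuation x ^ w.asIdeal.ramificationIdx A =
    w.intValuation (algebraMap A B x) := by
  classical
  have h_ne_zero := ramificationIdx_ne_zero A B hAB w
  by_cases hx : x = 0
  · simpa [hx]
  simp only [intValuation, Valuation.coe_mk, MonoidWithZeroHom.coe_mk, ZeroHom.coe_mk]
  change (ite _ _ _) ^ _ = ite _ _ _
  rw [map_eq_zero_iff _ hAB, if_neg hx, if_neg hx, ← Set.image_singleton,
    ← Ideal.map_span, mk_count_factors_map _ _ hAB, mul_comm, WithZero.exp, WithZero.exp]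
  simp

set_option backward.isDefEq.respectTransparency.types false in
omit [IsIntegralClosure B A L] in
/-- If w | v then for x ∈ K we have w(x)=v(x)^e where e is the ramification index.
(Mathlib: `valuation_liesOver`, `LiesOver`/`ramificationIdx'` form; see `intValuation_comap`.)
(In Mathlib's namespace `IsDedekindDomain.HeightOneSpectrum`: a deliberate extension under FLT's
name, for dot notation and so that the later packet files apply unchanged — CONVENTIONS §2.)
[cite: FLTProject2025, FLT/DedekindDomain/IntegralClosure.lean · IsDedekindDomain.HeightOneSpectrum.valuation_comap] -/
lemma valuation_comap (w : HeightOneSpectrum B) (x : K) :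
    (under A w).valuation K x ^ w.asIdeal.ramificationIdx A =
    w.valuation L (algebraMap K L x) := by
  obtain ⟨x, y, hy, rfl⟩ := IsFractionRing.div_surjective (A := A) x
  simp [valuation_def, ← IsScalarTower.algebraMap_apply A K L, IsScalarTower.algebraMap_apply A B L,
    ← intValuation_comap A B (algebraMap_injective_of_field_isFractionRing A B K L), div_pow]

include K L in
omit [IsDedekindDomain A] [IsIntegralClosure B A L]
    [Algebra.IsIntegral A B] [IsDedekindDomain B] [IsFractionRing B L] in
/-- `B` is torsion-free as an `A`-module (AKLB set-up: `B` a domain containing `A`).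
(In Mathlib's namespace `IsDedekindDomain.HeightOneSpectrum`: a deliberate extension under FLT's
name, for dot notation and so that the later packet files apply unchanged — CONVENTIONS §2.)
[cite: FLTProject2025, FLT/DedekindDomain/IntegralClosure.lean · IsDedekindDomain.HeightOneSpectrum.isTorsionFree] -/
lemma isTorsionFree [IsDomain B] : Module.IsTorsionFree A B := by
  have : FaithfulSMul A B := FaithfulSMul.of_field_isFractionRing A B K L
  have : Nontrivial A := (IsFractionRing.nontrivial_iff_nontrivial A K).mpr inferInstance
  infer_instance

include K L in
omit [IsIntegralClosure B A L] [IsFractionRing B L] in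
/-- There are only finitely many nonzero primes of B above a nonzero prime of A.
(In Mathlib's namespace `IsDedekindDomain.HeightOneSpectrum.Extension`: a deliberate extension
under FLT's name, for dot notation and so that the later packet files apply unchanged — CONVENTIONS §2.)
[cite: FLTProject2025, FLT/DedekindDomain/IntegralClosure.lean · IsDedekindDomain.HeightOneSpectrum.Extension.finite] -/
theorem Extension.finite (v : HeightOneSpectrum A) : Finite (v.Extension B) := by
  have := isTorsionFree A K L B
  rw [Extension, ← Set.coe_setOf]
  rw [@Set.finite_coe_iff]
  have := primesOver_finite v.asIdeal B
  refine Set.Finite.of_finite_image (f := HeightOneSpectrum.asIdeal) ?_ ?_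
  · refine Set.Finite.subset this ?_
    simp only [Set.subset_def, Set.mem_image, Set.mem_setOf_eq, forall_exists_index, and_imp,
      forall_apply_eq_imp_iff₂]
    rintro w rfl
    simp only [Ideal.primesOver, Set.mem_setOf_eq, isPrime, true_and]
    constructor
    simp [Ideal.under_def, under]
  · intro x hx y hy hxy
    rwa [← @HeightOneSpectrum.ext_iff] at hxy

/-- There are only finitely many nonzero primes of B above a nonzero prime of A.
(In Mathlib's namespace `IsDedekindDomain.HeightOneSpectrum.Extension`: a deliberate extension
under FLT's name, for dot notation and so that the later packet files apply unchanged — CONVENTIONS §2.)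
[cite: FLTProject2025, FLT/DedekindDomain/IntegralClosure.lean · IsDedekindDomain.HeightOneSpectrum.Extension.fintype] -/
@[reducible]
noncomputable def Extension.fintype : Fintype (Extension B v) :=
  have := Extension.finite A K L B v
  Fintype.ofFinite <| Extension B v

include K L in
omit [IsIntegralClosure B A L] [IsFractionRing B L] in
/-- Only finitely many primes of `B` lie over a given finite set of primes of `A` (`B`
module-finite over `A`).
(In Mathlib's namespace `IsDedekindDomain.HeightOneSpectrum`: a deliberate extension under FLT's
name, for dot notation and so that the later packet files apply unchanged — CONVENTIONS §2.)
[cite: FLTProject2025, FLT/DedekindDomain/IntegralClosure.lean · IsDedekindDomain.HeightOneSpectrum.preimage_comap_finite] -/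
theorem preimage_comap_finite (S : Set (HeightOneSpectrum A)) (hS : S.Finite) :
    ((under A : HeightOneSpectrum B → HeightOneSpectrum A) ⁻¹' S).Finite := by
  rw [← Set.biUnion_preimage_singleton (under A) S]
  exact Set.Finite.biUnion' hS <| fun v _ ↦ Extension.finite A K L B v

/-- Given an inclusion of Dedekind domains A → B, making B finite over A,
this is the preimage of a Finset of finite places of A, as a Finset of
finite places of B.
(In Mathlib's namespace `IsDedekindDomain.HeightOneSpectrum`: a deliberate extension under FLT's
name, for dot notation and so that the later packet files apply unchanged — CONVENTIONS §2.)
[cite: FLTProject2025, FLT/DedekindDomain/IntegralClosure.lean · IsDedekindDomain.HeightOneSpectrum.preimageComapFinset] -/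
noncomputable def preimageComapFinset (S : Finset (HeightOneSpectrum A)) :
    Finset (HeightOneSpectrum B) :=
  Set.Finite.toFinset <| preimage_comap_finite A K L B S S.finite_toSet

omit [IsIntegralClosure B A L] in
/-- The primes of `B` extending `v` are precisely the primes of `B` lying over `v.asIdeal`.
(In Mathlib's namespace `IsDedekindDomain.HeightOneSpectrum.Extension`: a deliberate extension
under FLT's name, for dot notation and so that the later packet files apply unchanged — CONVENTIONS §2.)
[cite: FLTProject2025, FLT/DedekindDomain/IntegralClosure.lean · IsDedekindDomain.HeightOneSpectrum.Extension.equivPrimesOver] -/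
noncomputable def Extension.equivPrimesOver : Extension B v ≃ v.asIdeal.primesOver B :=
  have := isTorsionFree A K L B
  { toFun w := ⟨w.1.asIdeal, w.1.isPrime, by obtain ⟨w, rfl⟩ := w; infer_instance⟩
    invFun Q := ⟨⟨Q.1, Q.2.1, Ideal.ne_bot_of_mem_primesOver v.ne_bot Q.2⟩,
      HeightOneSpectrum.ext Q.2.2.over.symm⟩
    left_inv _ := Subtype.ext (HeightOneSpectrum.ext rfl)
    right_inv _ := Subtype.ext rfl }

omit [IsIntegralClosure B A L] [IsFractionRing B L] in
/-- `Extension.equivPrimesOver` sends `w` to its underlying ideal.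
(In Mathlib's namespace `IsDedekindDomain.HeightOneSpectrum.Extension`: a deliberate extension
under FLT's name, for dot notation and so that the later packet files apply unchanged — CONVENTIONS §2.)
[cite: FLTProject2025, FLT/DedekindDomain/IntegralClosure.lean · IsDedekindDomain.HeightOneSpectrum.Extension.equivPrimesOver_apply] -/
@[simp]
lemma Extension.equivPrimesOver_apply (w : Extension B v) :
    (Extension.equivPrimesOver A K L B v w : Ideal B) = w.1.asIdeal :=
  rfl

omit [IsIntegralClosure B A L] in
/-- `Ideal.sum_ramification_inertia_eq_finrank`, rewritten as a sum over extensions.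
(In Mathlib's namespace `Ideal`: a deliberate extension under FLT's name, for dot notation and so
that the later packet files apply unchanged — CONVENTIONS §2.)
[cite: FLTProject2025, FLT/DedekindDomain/IntegralClosure.lean · Ideal.sum_ramification_inertia_extensions] -/
lemma _root_.Ideal.sum_ramification_inertia_extensions [Module.Finite A B] :
    letI := Extension.fintype A K L B v
    ∑ (w : Extension B v), w.val.asIdeal.ramificationIdx A * w.val.asIdeal.inertiaDeg A =
      Module.finrank K L := by
  let := Extension.fintype A K L B v
  have := v.isMaximal
  have := isTorsionFree A K L B
  -- Reduce to the fundamental identity for `B/A`, ...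
  -- (FLT: `IsFractionRing.finrank_eq` of its newer Mathlib; at this pin the same statement is
  -- `Algebra.IsAlgebraic.finrank_of_isFractionRing`)
  rw [Algebra.IsAlgebraic.finrank_of_isFractionRing A K B L,
    ← Ideal.sum_ramification_inertia_eq_finrank v.asIdeal B]
  -- ... whose sum ranges over the primes lying over `v.asIdeal` rather than over `v.Extension B`.
  exact Fintype.sum_equiv (Extension.equivPrimesOver A K L B v) _ _ fun _ ↦ by simp

end BaseChange

end IsDedekindDomain.HeightOneSpectrum

namespace IsDedekindDomain

open scoped TensorProduct

variable (A K L B : Type*) [CommRing A] [CommRing B] [Algebra A B] [Field K] [Field L]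
    [Algebra A K] [IsFractionRing A K] [Algebra B L] [IsDedekindDomain A]
    [Algebra K L] [Algebra A L] [IsScalarTower A B L] [IsScalarTower A K L]
    [IsIntegralClosure B A L] [Algebra.IsAlgebraic K L]

/-- The canonical `K`-linear isomorphism `L ≅ K ⊗ B`.
(In Mathlib's namespace `IsDedekindDomain`: a deliberate extension under FLT's name, for dot
notation and so that the later packet files apply unchanged — CONVENTIONS §2.)
[cite: FLTProject2025, FLT/DedekindDomain/IntegralClosure.lean · IsDedekindDomain.LinearEquivTensorProduct] -/
noncomputable def LinearEquivTensorProduct :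
    L ≃ₗ[K] K ⊗[A] B :=
  let f := LocalizedModule.equivTensorProduct (nonZeroDivisors A) B
  have := IsIntegralClosure.isLocalization A K L B
  have : IsLocalizedModule (nonZeroDivisors A) (IsScalarTower.toAlgHom A B L).toLinearMap :=
    inferInstance
  let g : LocalizedModule (nonZeroDivisors A) B ≃ₗ[A] L := @IsLocalizedModule.iso
      _ _ (nonZeroDivisors A) _ _ _ _ _ _ (IsScalarTower.toAlgHom A B L) this
  let h := TensorProduct.congr (Localization.algEquiv (nonZeroDivisors A) K) (LinearEquiv.refl A B)
  LinearEquiv.extendScalarsOfIsLocalization (nonZeroDivisors A) K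
    <| g.symm.trans (f.restrictScalars A) |>.trans h

set_option backward.isDefEq.respectTransparency.types false in
/-- `(LinearEquivTensorProduct A K L B).symm (1 ⊗ₜ b) = algebraMap B L b`.
(In Mathlib's namespace `IsDedekindDomain`: a deliberate extension under FLT's name, for dot
notation and so that the later packet files apply unchanged — CONVENTIONS §2.)
[cite: FLTProject2025, FLT/DedekindDomain/IntegralClosure.lean · IsDedekindDomain.LinearEquivTensorProduct_symm_one_tmul] -/
lemma LinearEquivTensorProduct_symm_one_tmul (b : B) :
    (LinearEquivTensorProduct A K L B).symm (1 ⊗ₜ b) =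
    (algebraMap _ _ b) := by simp [LinearEquivTensorProduct]

/-- `(LinearEquivTensorProduct A K L B).symm (k ⊗ₜ b) = k • algebraMap B L b`.
(In Mathlib's namespace `IsDedekindDomain`: a deliberate extension under FLT's name, for dot
notation and so that the later packet files apply unchanged — CONVENTIONS §2.)
[cite: FLTProject2025, FLT/DedekindDomain/IntegralClosure.lean · IsDedekindDomain.LinearEquivTensorProduct_symm_tmul] -/
lemma LinearEquivTensorProduct_symm_tmul (k : K) (b : B) :
    (LinearEquivTensorProduct A K L B).symm (k ⊗ₜ b) =
    k • (algebraMap _ _ b) := by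
  have : k ⊗ₜ b = k • (1 ⊗ₜ b : K ⊗[A] B) := by
    simp [TensorProduct.smul_tmul']
  rw [this, LinearEquiv.map_smul, LinearEquivTensorProduct_symm_one_tmul]

variable (M : Type*) [AddCommGroup M] [Module K M] [Module A M] [IsScalarTower A K M]

/-- The canonical `A`-linear isomorphism `L ⊗ M ≅ B ⊗ M` for any `K`-module `M`.
(In Mathlib's namespace `IsDedekindDomain`: a deliberate extension under FLT's name, for dot
notation and so that the later packet files apply unchanged — CONVENTIONS §2.)
[cite: FLTProject2025, FLT/DedekindDomain/IntegralClosure.lean · IsDedekindDomain.linearEquivTensorProductModule] -/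
noncomputable def linearEquivTensorProductModule : L ⊗[K] M ≃ₗ[A] B ⊗[A] M :=
  let f₁ : L ⊗[K] M ≃ₗ[A] L ⊗[A] M := IsLocalization.moduleTensorEquiv (nonZeroDivisors A) K L M
    |>.restrictScalars A
  let f₂ : L ≃ₗ[A] B ⊗[A] K := LinearEquivTensorProduct A K L B
    |>.restrictScalars A
    |>.trans (TensorProduct.comm A K B)
  let f₃ : L ⊗[A] M ≃ₗ[A] (B ⊗[A] K) ⊗[A] M := TensorProduct.congr f₂ (LinearEquiv.refl A M)
  let f₄ : (B ⊗[A] K) ⊗[A] M ≃ₗ[A] B ⊗[A] (K ⊗[A] M) :=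
    TensorProduct.assoc A B K M
  let f₅ : B ⊗[A] (K ⊗[A] M) ≃ₗ[A] B ⊗[A] M := TensorProduct.congr (LinearEquiv.refl A B)
    (IsLocalization.moduleLid (nonZeroDivisors A) K M |>.restrictScalars A)
  f₁.trans f₃ |>.trans f₄ |>.trans f₅

/-- The canonical `B`-linear isomorphism `L ⊗ M ≅ B ⊗ M` for any `K`-module `M`.
(In Mathlib's namespace `IsDedekindDomain`: a deliberate extension under FLT's name, for dot
notation and so that the later packet files apply unchanged — CONVENTIONS §2.)
[cite: FLTProject2025, FLT/DedekindDomain/IntegralClosure.lean · IsDedekindDomain.linearEquivTensorProductModuleLeft] -/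
noncomputable def linearEquivTensorProductModuleLeft : L ⊗[K] M ≃ₗ[B] B ⊗[A] M :=
  let f₁ : L ⊗[K] M ≃ₗ[B] L ⊗[A] M :=
    IsLocalization.leftModuleTensorEquiv B (nonZeroDivisors A) K L M
  let f₂ : B ⊗[A] K ≃ₗ[B] L := {
    __ := LinearEquivTensorProduct A K L B
        |>.restrictScalars A
        |>.trans (TensorProduct.comm A K B) |>.symm
    map_smul' b x := by
      induction x with
      | zero => simp
      | tmul l m => simp [LinearEquivTensorProduct_symm_tmul, Algebra.smul_def]; ring
      | add => simp_all
    }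
  let f₃ : (B ⊗[A] K) ⊗[A] M ≃ₗ[B] L ⊗[A] M :=
    TensorProduct.AlgebraTensorModule.congr f₂ (LinearEquiv.refl A M)
  let f₄ : (B ⊗[A] K) ⊗[A] M ≃ₗ[B] B ⊗[A] (K ⊗[A] M) :=
    TensorProduct.AlgebraTensorModule.assoc _ A B _ K M
  let f₅ : B ⊗[A] (K ⊗[A] M) ≃ₗ[B] B ⊗[A] M :=
    TensorProduct.AlgebraTensorModule.congr (LinearEquiv.refl B B)
      (IsLocalization.moduleLid (nonZeroDivisors A) K M |>.restrictScalars A)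
  f₁.trans f₃.symm |>.trans f₄ |>.trans f₅

/-- `linearEquivTensorProductModuleLeft` restricted to `A`-scalars is
`linearEquivTensorProductModule`.
(In Mathlib's namespace `IsDedekindDomain`: a deliberate extension under FLT's name, for dot
notation and so that the later packet files apply unchanged — CONVENTIONS §2.)
[cite: FLTProject2025, FLT/DedekindDomain/IntegralClosure.lean · IsDedekindDomain.linearEquivTensorProductModuleLeft_restrictScalars] -/
lemma linearEquivTensorProductModuleLeft_restrictScalars :
    (linearEquivTensorProductModuleLeft A K L B M).restrictScalars A =
      linearEquivTensorProductModule A K L B M := by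
  rfl

/-- `(linearEquivTensorProductModule A K L B M).symm (b ⊗ₜ m) = algebraMap B L b ⊗ₜ m`.
(In Mathlib's namespace `IsDedekindDomain`: a deliberate extension under FLT's name, for dot
notation and so that the later packet files apply unchanged — CONVENTIONS §2.)
[cite: FLTProject2025, FLT/DedekindDomain/IntegralClosure.lean · IsDedekindDomain.linearEquivTensorProductModule_symm_tmul] -/
lemma linearEquivTensorProductModule_symm_tmul (b : B) (m : M) :
    (linearEquivTensorProductModule A K L B M).symm (b ⊗ₜ m) = (algebraMap B L b) ⊗ₜ m := by
  simp [linearEquivTensorProductModule, LinearEquivTensorProduct_symm_one_tmul]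
  -- this proof breaks until someone PRs the simp lemmas in the import

/-- `linearEquivTensorProductModule A K L B M (algebraMap B L b ⊗ₜ m) = b ⊗ₜ m`.
(In Mathlib's namespace `IsDedekindDomain`: a deliberate extension under FLT's name, for dot
notation and so that the later packet files apply unchanged — CONVENTIONS §2.)
[cite: FLTProject2025, FLT/DedekindDomain/IntegralClosure.lean · IsDedekindDomain.linearEquivTensorProductModule_tmul] -/
lemma linearEquivTensorProductModule_tmul (b : B) (m : M) :
    (linearEquivTensorProductModule A K L B M) ((algebraMap B L b) ⊗ₜ m) = b ⊗ₜ m := by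
  rw [← LinearEquiv.eq_symm_apply, linearEquivTensorProductModule_symm_tmul]

/-- `(linearEquivTensorProductModuleLeft A K L B M).symm (b ⊗ₜ m) = algebraMap B L b ⊗ₜ m`.
(In Mathlib's namespace `IsDedekindDomain`: a deliberate extension under FLT's name, for dot
notation and so that the later packet files apply unchanged — CONVENTIONS §2.)
[cite: FLTProject2025, FLT/DedekindDomain/IntegralClosure.lean · IsDedekindDomain.linearEquivTensorProductModuleLeft_symm_tmul] -/
lemma linearEquivTensorProductModuleLeft_symm_tmul (b : B) (m : M) :
    (linearEquivTensorProductModuleLeft A K L B M).symm (b ⊗ₜ m) = (algebraMap B L b) ⊗ₜ m := by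
  simp [linearEquivTensorProductModuleLeft, LinearEquivTensorProduct_symm_one_tmul]

/-- `linearEquivTensorProductModuleLeft A K L B M (algebraMap B L b ⊗ₜ m) = b ⊗ₜ m`.
(In Mathlib's namespace `IsDedekindDomain`: a deliberate extension under FLT's name, for dot
notation and so that the later packet files apply unchanged — CONVENTIONS §2.)
[cite: FLTProject2025, FLT/DedekindDomain/IntegralClosure.lean · IsDedekindDomain.linearEquivTensorProductModuleLeft_tmul] -/
lemma linearEquivTensorProductModuleLeft_tmul (b : B) (m : M) :
    (linearEquivTensorProductModuleLeft A K L B M) ((algebraMap B L b) ⊗ₜ m) = b ⊗ₜ m := by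
  rw [← LinearEquiv.eq_symm_apply, linearEquivTensorProductModuleLeft_symm_tmul]

end IsDedekindDomain

variable (A K L B : Type*) [CommRing A] [CommRing B] [Algebra A B] [Field K] [Field L]
    [Algebra A K] [IsFractionRing A K] [Algebra B L] [IsDedekindDomain A]
    [Algebra K L] [Algebra A L] [IsScalarTower A B L] [IsScalarTower A K L]
    [IsIntegralClosure B A L] [Algebra.IsAlgebraic K L]

include K in
/-- In the AKLB set-up, `L` is the localization of the `A`-module `B` at the non-zero-divisors of
`A`: `Algebra.linearMap B L` (restricted to `A`) satisfies `IsLocalizedModule (nonZeroDivisors A)`.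
(In Mathlib's namespace `IsIntegralClosure`: a deliberate extension under FLT's name, for dot
notation and so that the later packet files apply unchanged — CONVENTIONS §2.)
[cite: FLTProject2025, FLT/DedekindDomain/IntegralClosure.lean · IsIntegralClosure.isLocalizedModule] -/
lemma _root_.IsIntegralClosure.isLocalizedModule : IsLocalizedModule (nonZeroDivisors A)
    ((Algebra.linearMap B L).restrictScalars A) := by
  have hlocal := IsIntegralClosure.isLocalization A K L B
  rw [← isLocalizedModule_iff_isLocalization'] at hlocal
  exact {
    map_units x := by
      obtain ⟨x, hx⟩ := x
      simpa only [← IsScalarTower.algebraMap_apply, Module.End.isUnit_iff]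
          using! hlocal.map_units ⟨_, x, hx, rfl⟩
    surj y := by
      obtain ⟨⟨b, _, s, hs, rfl⟩, hx⟩ := (hlocal.surj) y
      exact ⟨(b, ⟨s, hs⟩), by simpa [Submonoid.smul_def] using hx⟩
    exists_of_eq {x₁ x₂} e := by
      obtain ⟨⟨_, c, hc, rfl⟩, he⟩ := hlocal.exists_of_eq e
      use ⟨c, hc⟩
      simpa only [Submonoid.smul_def, smul_eq_mul, Algebra.smul_def] using he
  }

end
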